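import Mathlib
import Summits.NavierStokesRegularity.NavierStokesRegularity.Theorems.LevelSetModerationHighSpeedPressureWorkIsoSpeedStubs
import Summits.NavierStokesRegularity.NavierStokesRegularity.Theorems.LevelSetModerationHighSpeedPressureWorkSlabBounds
import Summits.NavierStokesRegularity.NavierStokesRegularity.Theorems.LevelSetModerationHighSpeedPressureWorkCruxStructure
import Summits.NavierStokesRegularity.NavierStokesRegularity.Theorems.LevelSetModerationHighSpeedPressureWorkIsoSpeedAreaOfCrux

/-!
# Route LevelSetModeration — crux 2 `HighSpeedPressureWork`: the AREA LAW closes (class-uniform speed bound)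

Proof file for item stmt-NavierStokesRegularity-18149 (`HighSpeedPressureWork`), line
`iso-speed-area-closure`: the closure step of the line, proved here independently of the skeleton and
landed as a theorem of the item:

* `levelSetModeration_areaLawClosure` — an iso-speed AREA LAW on the fibre `(ν, T)`
  (`ν 𝒟¹_c(T) ≤ Λ₁(E₀,B₀) M^{m₁} V_c(T)` for `M ≥ 2B₀`, `c ∈ [M/2, M]`, with `m₁ < 5/3`) forces a
  CLASS-UNIFORM a priori speed bound `‖u‖ ≤ G(E₀, B₀)` on `[0, T) × ℝ³`. Mechanism: the linear dyadic
  recursion `V_{2c} ≤ θ(c) V_c`, `θ(c) = C E₀^{1/3} Λ₁⁺ 2^{m₁} ν⁻¹ c^{m₁ − 5/3}` (`stub_linearLevelRecursion`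
  + the law at `M = 2c`) decays super-geometrically along the levels `2^k c₁` once `θ(c₁) ≤ 1/2`, against
  the polynomial occupation quantum `κ ν⁴/G⁵ ≤ V_{G/2}` at the running maximum `G`
  (`stub_occupationQuantum`, which carries the early window); so `G < 2^{K+2} c₁`, `K` explicit.
* `levelSetModeration_highSpeedPressureWork_of_areaLaw_of_bookkeeping` — AREA LAW ∧ bounded pairing
  bookkeeping (L3) ⇒ the crux (exponent `0`). With the landed converse
  `levelSetModeration_isoSpeedAreaLaw_of_highSpeedPressureWork` (crux ⇒ area law) and
  `levelSetModeration_boundedPairingBookkeeping_of_highSpeedPressureWork` (crux ⇒ L3):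
  `levelSetModeration_highSpeedPressureWork_iff_areaLaw_and_bookkeeping` — **crux ⟺ area law ∧ L3**.
-/

noncomputable section

-- single-conjunct summit: `Summit.<Summit>.<Problem>` repeats the name by the D-0017 layout
set_option linter.dupNamespace false

namespace Summit.NavierStokesRegularity.NavierStokesRegularity.Theorems

open MeasureTheory Set Filter Topology Function Metric
open scoped ENNReal NNReal
open Literature.Analysis.FluidPDE

/-! ### Real-variable lemmas: the super-geometric dyadic product -/

/-- **Super-geometric decay beats any geometric growth**: for `γ > 0` and `Ξ ≥ 0` there is `K` such
that `2^{γ k (k−1)/2} ≥ Ξ · 2^{4k}` for all natural `k > K`. [folklore] -/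
theorem levelSetModeration_exists_superGeometric_dominates {γ Ξ : ℝ} (hγ : 0 < γ) (_hΞ : 0 ≤ Ξ) :
    ∃ K : ℕ, ∀ k : ℕ, K < k →
      Ξ * (2 : ℝ) ^ (4 * (k : ℝ)) ≤ (2 : ℝ) ^ (γ * ((k : ℝ) * ((k : ℝ) - 1) / 2)) := by
  -- `K₁`: beyond it the exponent exceeds `5k`; `K₂`: `2^{K₂} ≥ Ξ`
  obtain ⟨K₁, hK₁⟩ := exists_nat_gt (1 + 10 / γ)
  obtain ⟨K₂, hK₂⟩ := exists_nat_gt Ξ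
  refine ⟨max K₁ K₂, fun k hk => ?_⟩
  have hk₁ : (K₁ : ℝ) < k := by exact_mod_cast (le_max_left K₁ K₂).trans_lt hk
  have hk₂ : (K₂ : ℝ) < k := by exact_mod_cast (le_max_right K₁ K₂).trans_lt hk
  -- exponent comparison: `γ k (k-1)/2 ≥ 5k` since `γ (k-1)/2 ≥ 5`
  have hexp : 5 * (k : ℝ) ≤ γ * ((k : ℝ) * ((k : ℝ) - 1) / 2) := by
    have h1 : 1 + 10 / γ < k := (hK₁.trans hk₁)
    have h2 : 10 / γ < (k : ℝ) - 1 := by linarith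
    have h3 : 10 < γ * ((k : ℝ) - 1) := by
      have := mul_lt_mul_of_pos_left h2 hγ
      rwa [mul_div_cancel₀ _ hγ.ne'] at this
    nlinarith
  have hΞ2 : Ξ ≤ (2 : ℝ) ^ (k : ℝ) := by
    have h1 : Ξ < (K₂ : ℝ) := hK₂
    have h2 : (K₂ : ℝ) < (2 : ℝ) ^ (K₂ : ℝ) := by
      rw [Real.rpow_natCast]; exact_mod_cast K₂.lt_two_pow_self
    have h3 : (2 : ℝ) ^ (K₂ : ℝ) ≤ (2 : ℝ) ^ (k : ℝ) :=
      Real.rpow_le_rpow_of_exponent_le one_le_two hk₂.le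
    linarith
  calc Ξ * (2 : ℝ) ^ (4 * (k : ℝ)) ≤ (2 : ℝ) ^ (k : ℝ) * (2 : ℝ) ^ (4 * (k : ℝ)) := by gcongr
    _ = (2 : ℝ) ^ (5 * (k : ℝ)) := by rw [← Real.rpow_add two_pos]; ring_nf
    _ ≤ (2 : ℝ) ^ (γ * ((k : ℝ) * ((k : ℝ) - 1) / 2)) :=
        Real.rpow_le_rpow_of_exponent_le one_le_two hexp

/-! ### The closure -/

/-- **AREA LAW CLOSURE (the iso-speed area law forces a class-uniform speed bound).** Let `ν, T > 0`,
`m₁ < 5/3`, `Λ₁ : ℝ → ℝ → ℝ`, and suppose every classical solution on `ℝ³ × [0,T)` that is Leray–Hopf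
from a rapidly decaying datum with `∫|u₀|² ≤ E₀`, `|u₀| ≤ B₀` obeys the AREA LAW
`ν · 𝒟¹_c(T) ≤ Λ₁(E₀,B₀) · M^{m₁} · V_c(T)` for all `M ≥ 2B₀`, `c ∈ [M/2, M]`, `c > 0` (real-valued
forms). Then there is `G : ℝ → ℝ → ℝ` with `‖u(t, x)‖ ≤ G(E₀, B₀)` on `[0, T) × ℝ³` for every such
solution (linear dyadic recursion `stub_linearLevelRecursion` + occupation quantum
`stub_occupationQuantum`; the running maximum over `[0, T']` is finite by the slab bounds and the sup is
approached at a point, so the quantum applies). [folklore] -/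
theorem levelSetModeration_areaLawClosure :
    ∀ (ν T : ℝ), 0 < ν → 0 < T → ∀ (m₁ : ℝ) (Λ₁ : ℝ → ℝ → ℝ), m₁ < 5 / 3 →
      (∀ (u : ℝ → EuclideanSpace ℝ (Fin 3) → EuclideanSpace ℝ (Fin 3))
          (p : ℝ → EuclideanSpace ℝ (Fin 3) → ℝ),
          Literature.Analysis.FluidPDE.IsClassicalNSSolutionOn (Set.Ico 0 T) ν 0 u p →
          Literature.Analysis.FluidPDE.IsLerayHopfOn T ν 0 (u 0) u →
          Literature.Analysis.FluidPDE.HasRapidSpatialDecay (u 0) →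
          ∀ (E₀ B₀ : ℝ), (∫ x, ‖u 0 x‖ ^ 2) ≤ E₀ → (∀ x, ‖u 0 x‖ ≤ B₀) →
          ∀ (M c : ℝ), 2 * B₀ ≤ M → M / 2 ≤ c → c ≤ M → 0 < c →
          ν * (∫⁻ τ in Set.Ioo 0 T, ∫⁻ x, Set.indicator {x | c < ‖u τ x‖}
              (fun x => ENNReal.ofReal ‖fderiv ℝ (fun y => ‖u τ y‖) x‖) x).toReal ≤
            Λ₁ E₀ B₀ * M ^ m₁ * (∫⁻ τ in Set.Ioo 0 T, volume {x | c < ‖u τ x‖}).toReal) →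
      ∃ G : ℝ → ℝ → ℝ,
        ∀ (u : ℝ → EuclideanSpace ℝ (Fin 3) → EuclideanSpace ℝ (Fin 3))
          (p : ℝ → EuclideanSpace ℝ (Fin 3) → ℝ),
          Literature.Analysis.FluidPDE.IsClassicalNSSolutionOn (Set.Ico 0 T) ν 0 u p →
          Literature.Analysis.FluidPDE.IsLerayHopfOn T ν 0 (u 0) u →
          Literature.Analysis.FluidPDE.HasRapidSpatialDecay (u 0) →
          ∀ (E₀ B₀ : ℝ), (∫ x, ‖u 0 x‖ ^ 2) ≤ E₀ → (∀ x, ‖u 0 x‖ ≤ B₀) →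
          ∀ t ∈ Set.Ico 0 T, ∀ x, ‖u t x‖ ≤ G E₀ B₀ := by
  intro ν T hν hT m₁ Λ₁ hm₁ hlaw
  obtain ⟨CR, hCR, hrec⟩ := stub_linearLevelRecursion
  obtain ⟨κ, A₀, hκ, hA₀, hQ⟩ := stub_occupationQuantum
  set γ : ℝ := 5 / 3 - m₁ with hγdef
  have hγ : 0 < γ := by rw [hγdef]; linarith
  -- the data-dependent constants
  set Θ : ℝ → ℝ → ℝ := fun E₀ B₀ =>
    CR * (max E₀ 0) ^ (1 / 3 : ℝ) * max (Λ₁ E₀ B₀) 0 * (2 : ℝ) ^ m₁ / ν with hΘ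
  have hΘ0 : ∀ E₀ B₀, 0 ≤ Θ E₀ B₀ := fun E₀ B₀ => by
    show 0 ≤ CR * (max E₀ 0) ^ (1 / 3 : ℝ) * max (Λ₁ E₀ B₀) 0 * (2 : ℝ) ^ m₁ / ν
    positivity
  set c₁ : ℝ → ℝ → ℝ := fun E₀ B₀ =>
    max (max B₀ 1) ((2 * Θ E₀ B₀ + 1) ^ (1 / γ)) with hc₁
  have hc₁1 : ∀ E₀ B₀, 1 ≤ c₁ E₀ B₀ := fun E₀ B₀ =>
    (le_max_right B₀ 1).trans (le_max_left _ _)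
  have hc₁B : ∀ E₀ B₀, B₀ ≤ c₁ E₀ B₀ := fun E₀ B₀ =>
    (le_max_left B₀ 1).trans (le_max_left _ _)
  have hc₁pos : ∀ E₀ B₀, 0 < c₁ E₀ B₀ := fun E₀ B₀ => lt_of_lt_of_le one_pos (hc₁1 E₀ B₀)
  have hc₁Θ : ∀ E₀ B₀, Θ E₀ B₀ * (c₁ E₀ B₀) ^ (-γ) ≤ 1 / 2 := by
    intro E₀ B₀
    have h1 : (2 * Θ E₀ B₀ + 1) ^ (1 / γ) ≤ c₁ E₀ B₀ := le_max_right _ _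
    have h2 : 2 * Θ E₀ B₀ + 1 ≤ (c₁ E₀ B₀) ^ γ := by
      have := Real.rpow_le_rpow (by positivity) h1 hγ.le
      rwa [← Real.rpow_mul (by linarith [hΘ0 E₀ B₀]), one_div_mul_cancel hγ.ne', Real.rpow_one] at this
    rw [Real.rpow_neg (hc₁pos E₀ B₀).le, ← div_eq_mul_inv, div_le_iff₀ (Real.rpow_pos_of_pos (hc₁pos E₀ B₀) γ)]
    nlinarith [hΘ0 E₀ B₀]
  set Ξ : ℝ → ℝ → ℝ := fun E₀ B₀ =>
    T * max E₀ 0 * (c₁ E₀ B₀) ^ 3 * (2 : ℝ) ^ (10 : ℝ) / (κ * ν ^ 4) with hΞ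
  have hΞ0 : ∀ E₀ B₀, 0 ≤ Ξ E₀ B₀ := fun E₀ B₀ => by
    show 0 ≤ T * max E₀ 0 * (c₁ E₀ B₀) ^ 3 * (2 : ℝ) ^ (10 : ℝ) / (κ * ν ^ 4)
    have := hc₁pos E₀ B₀; positivity
  -- the index `K(E₀,B₀)` beyond which the super-geometric product wins
  have hK : ∀ E₀ B₀, ∃ K : ℕ, ∀ k : ℕ, K < k →
      Ξ E₀ B₀ * (2 : ℝ) ^ (4 * (k : ℝ)) ≤ (2 : ℝ) ^ (γ * ((k : ℝ) * ((k : ℝ) - 1) / 2)) :=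
    fun E₀ B₀ => levelSetModeration_exists_superGeometric_dominates hγ (hΞ0 E₀ B₀)
  choose K hKspec using hK
  -- the bound
  refine ⟨fun E₀ B₀ => max (A₀ * B₀) (4 * c₁ E₀ B₀ * (2 : ℝ) ^ (K E₀ B₀)), ?_⟩
  intro u p hcl hLH hdec E₀ B₀ hE₀ hB₀bd t ht x
  have hE₀0 : 0 ≤ E₀ := le_trans (integral_nonneg fun _ => sq_nonneg _) hE₀
  have hmaxE : max E₀ 0 = E₀ := max_eq_left hE₀0
  have hGb_pos : 0 < 4 * c₁ E₀ B₀ * (2 : ℝ) ^ (K E₀ B₀) := by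
    have := hc₁pos E₀ B₀; positivity
  -- the degenerate datum `B₀ ≤ 0`: `u ≡ 0`
  rcases le_or_gt B₀ 0 with hB₀ | hB₀
  · have h0 : ∀ y, u 0 y = 0 := fun y => norm_le_zero_iff.1 ((hB₀bd y).trans hB₀)
    have := levelSetModeration_eq_zero_of_datum_eq_zero hν hcl hLH h0 ht x
    rw [this, norm_zero]
    exact le_trans hGb_pos.le (le_max_right _ _)
  -- `B₀ > 0`: the running maximum on `[0, T']`, `T' = (t + T)/2`
  set T' : ℝ := (t + T) / 2 with hT'
  have hT'pos : 0 < T' := by rw [hT']; linarith [ht.1]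
  have hT'T : T' < T := by rw [hT']; linarith [ht.2]
  have htT' : t ≤ T' := by rw [hT']; linarith [ht.2]
  obtain ⟨Mb, -, hMb⟩ := levelSetModeration_slab_velocity_bound hν hcl hLH hdec ⟨hT'pos, hT'T⟩
  set S : Set ℝ := (fun q : ℝ × EuclideanSpace ℝ (Fin 3) => ‖u q.1 q.2‖) '' (Icc 0 T' ×ˢ univ) with hS
  have hSbdd : BddAbove S := by
    refine ⟨Mb, ?_⟩
    rintro a ⟨⟨s, y⟩, ⟨hs, -⟩, rfl⟩
    exact hMb s hs y
  have hSne : S.Nonempty := ⟨‖u 0 0‖, ⟨(0, 0), ⟨⟨le_rfl, hT'pos.le⟩, mem_univ _⟩, rfl⟩⟩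
  set G : ℝ := sSup S with hG
  have hGbd : ∀ s ∈ Icc 0 T', ∀ y, ‖u s y‖ ≤ G := fun s hs y =>
    le_csSup hSbdd ⟨(s, y), ⟨hs, mem_univ y⟩, rfl⟩
  -- it suffices to bound `G`
  suffices hGle : G ≤ max (A₀ * B₀) (4 * c₁ E₀ B₀ * (2 : ℝ) ^ (K E₀ B₀)) from
    (hGbd t ⟨ht.1, htT'⟩ x).trans hGle
  by_contra hGgt
  rw [not_le] at hGgt
  have hGA : A₀ * B₀ < G := lt_of_le_of_lt (le_max_left _ _) hGgt
  have hGc : 4 * c₁ E₀ B₀ * (2 : ℝ) ^ (K E₀ B₀) < G := lt_of_le_of_lt (le_max_right _ _) hGgt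
  have hGpos : 0 < G := lt_trans (by positivity) hGA
  -- a near-maximum point
  obtain ⟨a, ⟨⟨s₂, y₂⟩, ⟨hs₂, -⟩, rfl⟩, ha⟩ :=
    exists_lt_of_lt_csSup hSne (show 3 / 4 * G < sSup S by rw [← hG]; linarith)
  -- the occupation quantum at level `G/2`
  have hquant : κ * ν ^ 4 / G ^ 5 ≤
      (∫⁻ τ in Ioo 0 T, volume {x | G / 2 < ‖u τ x‖}).toReal :=
    hQ ν T u p hν hT hcl hLH hdec B₀ hB₀ hB₀bd T' G hT'T hGA.le hGbd ⟨s₂, hs₂, y₂, ha⟩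
  -- the dyadic levels `2^k c₁`
  set cc : ℝ := c₁ E₀ B₀ with hcc
  have hccpos : 0 < cc := hc₁pos E₀ B₀
  have hccB : B₀ ≤ cc := hc₁B E₀ B₀
  set V : ℕ → ℝ := fun k => (∫⁻ τ in Ioo 0 T, volume {x | (2 : ℝ) ^ k * cc < ‖u τ x‖}).toReal with hV
  have hVfin : ∀ c : ℝ, 0 < c → (∫⁻ τ in Ioo 0 T, volume {x | c < ‖u τ x‖}) ≠ ⊤ := fun c hc =>
    ne_top_of_le_ne_top ENNReal.ofReal_ne_top (levelSetVolume_le hLH hν.le hT.le hc)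
  -- one recursion step: `V (k+1) ≤ (1/2) 2^{-γ k} V k`
  have hstep : ∀ k : ℕ, V (k + 1) ≤ (1 / 2) * (2 : ℝ) ^ (-(γ * k)) * V k := by
    intro k
    set c : ℝ := (2 : ℝ) ^ k * cc with hc
    have hcpos : 0 < c := by rw [hc]; positivity
    have hcB : B₀ ≤ c := by
      rw [hc]
      calc B₀ ≤ cc := hccB
        _ = 1 * cc := (one_mul _).symm
        _ ≤ (2 : ℝ) ^ k * cc := by gcongr; exact one_le_pow₀ one_le_two
    -- the recursion and the law at `M = 2c`, level `c`
    obtain ⟨hDfin, hR⟩ := hrec ν T u p hν hT hcl hLH hdec E₀ c hE₀ hcpos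
    have hL := hlaw u p hcl hLH hdec E₀ B₀ hE₀ hB₀bd (2 * c) c (by linarith) (by linarith)
      (by linarith) hcpos
    set A : ℝ := (∫⁻ τ in Ioo 0 T, ∫⁻ x, {x | c < ‖u τ x‖}.indicator
      (fun x => ENNReal.ofReal ‖fderiv ℝ (fun y => ‖u τ y‖) x‖) x).toReal with hA
    have hA0 : 0 ≤ A := ENNReal.toReal_nonneg
    have hVk : V k = (∫⁻ τ in Ioo 0 T, volume {x | c < ‖u τ x‖}).toReal := rfl
    have hVk1 : V (k + 1) = (∫⁻ τ in Ioo 0 T, volume {x | 2 * c < ‖u τ x‖}).toReal := by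
      simp only [hV, hc, pow_succ]; ring_nf
    have hVk0 : 0 ≤ V k := ENNReal.toReal_nonneg
    -- `Λ₁ ≤ Λ⁺`
    have hL' : ν * A ≤ max (Λ₁ E₀ B₀) 0 * (2 * c) ^ m₁ * V k := by
      have hfac : 0 ≤ (2 * c) ^ m₁ * V k := mul_nonneg (Real.rpow_nonneg (by linarith) m₁) hVk0
      calc ν * A ≤ Λ₁ E₀ B₀ * (2 * c) ^ m₁ * V k := by rw [hVk]; exact hL
        _ = Λ₁ E₀ B₀ * ((2 * c) ^ m₁ * V k) := by ring
        _ ≤ max (Λ₁ E₀ B₀) 0 * ((2 * c) ^ m₁ * V k) :=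
            mul_le_mul_of_nonneg_right (le_max_left _ _) hfac
        _ = max (Λ₁ E₀ B₀) 0 * (2 * c) ^ m₁ * V k := by ring
    -- combine
    have hcomb : V (k + 1) ≤ CR * E₀ ^ (1 / 3 : ℝ) * c ^ (-(5 / 3 : ℝ)) *
        (max (Λ₁ E₀ B₀) 0 * (2 * c) ^ m₁ * V k / ν) := by
      rw [hVk1]
      refine hR.trans ?_
      have hK0 : 0 ≤ CR * E₀ ^ (1 / 3 : ℝ) * c ^ (-(5 / 3 : ℝ)) := by positivity
      refine mul_le_mul_of_nonneg_left ?_ hK0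
      rw [le_div_iff₀ hν]
      linarith
    -- the algebra: the right-hand side is `Θ c^{-γ} V k`
    have h2c : (2 * c) ^ m₁ = (2 : ℝ) ^ m₁ * c ^ m₁ := Real.mul_rpow zero_le_two hcpos.le
    have hcexp : c ^ (-(5 / 3 : ℝ)) * c ^ m₁ = c ^ (-γ) := by
      rw [← Real.rpow_add hcpos, hγdef]; ring_nf
    have hΘE : Θ E₀ B₀ = CR * E₀ ^ (1 / 3 : ℝ) * max (Λ₁ E₀ B₀) 0 * (2 : ℝ) ^ m₁ / ν := by
      show CR * (max E₀ 0) ^ (1 / 3 : ℝ) * max (Λ₁ E₀ B₀) 0 * (2 : ℝ) ^ m₁ / ν = _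
      rw [hmaxE]
    have hΘeq : CR * E₀ ^ (1 / 3 : ℝ) * c ^ (-(5 / 3 : ℝ)) *
        (max (Λ₁ E₀ B₀) 0 * (2 * c) ^ m₁ * V k / ν) = Θ E₀ B₀ * c ^ (-γ) * V k := by
      rw [hΘE, h2c, ← hcexp]
      rw [div_mul_eq_mul_div, div_mul_eq_mul_div, mul_div_assoc, mul_div_assoc]
      ring
    have hcγ : Θ E₀ B₀ * c ^ (-γ) ≤ (1 / 2) * (2 : ℝ) ^ (-(γ * k)) := by
      rw [hc, Real.mul_rpow (by positivity) hccpos.le, ← Real.rpow_natCast (2 : ℝ) k,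
        ← Real.rpow_mul zero_le_two]
      have h1 := hc₁Θ E₀ B₀
      rw [← hcc] at h1
      have h2 : 0 ≤ (2 : ℝ) ^ ((k : ℝ) * -γ) := Real.rpow_nonneg zero_le_two _
      calc Θ E₀ B₀ * ((2 : ℝ) ^ ((k : ℝ) * -γ) * cc ^ (-γ))
          = (2 : ℝ) ^ ((k : ℝ) * -γ) * (Θ E₀ B₀ * cc ^ (-γ)) := by ring
        _ ≤ (2 : ℝ) ^ ((k : ℝ) * -γ) * (1 / 2) := mul_le_mul_of_nonneg_left h1 h2
        _ = (1 / 2) * (2 : ℝ) ^ (-(γ * k)) := by ring_nf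
    calc V (k + 1) ≤ Θ E₀ B₀ * c ^ (-γ) * V k := by rw [← hΘeq]; exact hcomb
      _ ≤ (1 / 2) * (2 : ℝ) ^ (-(γ * k)) * V k := mul_le_mul_of_nonneg_right hcγ hVk0
  -- the super-geometric bound by induction
  have hind : ∀ k : ℕ, V k ≤ V 0 * (1 / 2) ^ k * (2 : ℝ) ^ (-(γ * ((k : ℝ) * ((k : ℝ) - 1) / 2))) := by
    intro k
    induction k with
    | zero => simp
    | succ k ih =>
      have hVk0 : 0 ≤ V 0 := ENNReal.toReal_nonneg
      have hfac : 0 ≤ (1 / 2) * (2 : ℝ) ^ (-(γ * k)) := by positivity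
      calc V (k + 1) ≤ (1 / 2) * (2 : ℝ) ^ (-(γ * k)) * V k := hstep k
        _ ≤ (1 / 2) * (2 : ℝ) ^ (-(γ * k)) *
            (V 0 * (1 / 2) ^ k * (2 : ℝ) ^ (-(γ * ((k : ℝ) * ((k : ℝ) - 1) / 2)))) :=
          mul_le_mul_of_nonneg_left ih hfac
        _ = V 0 * (1 / 2) ^ (k + 1) * (2 : ℝ) ^ (-(γ * (((k + 1 : ℕ) : ℝ) * (((k + 1 : ℕ) : ℝ) - 1) / 2))) := by
          rw [pow_succ, Nat.cast_succ]
          rw [show -(γ * (((k : ℝ) + 1) * ((k : ℝ) + 1 - 1) / 2)) =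
              -(γ * k) + -(γ * ((k : ℝ) * ((k : ℝ) - 1) / 2)) by ring, Real.rpow_add two_pos]
          ring
  -- `V 0 ≤ T E₀ / cc²`
  have hV0 : V 0 ≤ T * E₀ / cc ^ 2 := by
    have h1 := levelSetVolume_le hLH hν.le hT.le hccpos
    have hV0eq : V 0 = (∫⁻ τ in Ioo 0 T, volume {x | cc < ‖u τ x‖}).toReal := by
      simp only [hV, pow_zero, one_mul]
    rw [hV0eq]
    refine (ENNReal.toReal_mono ENNReal.ofReal_ne_top h1).trans ?_
    have hnn : 0 ≤ T * ((∫ y, ‖u 0 y‖ ^ 2) / cc ^ 2) :=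
      mul_nonneg hT.le (div_nonneg (integral_nonneg fun _ => sq_nonneg _) (sq_nonneg _))
    rw [ENNReal.toReal_ofReal hnn, mul_div_assoc]
    exact mul_le_mul_of_nonneg_left (div_le_div_of_nonneg_right hE₀ (sq_nonneg _)) hT.le
  -- the dyadic index of `G/2`
  have hG2c : 1 ≤ G / (2 * cc) := by
    rw [le_div_iff₀ (by positivity)]
    have : (1 : ℝ) ≤ (2 : ℝ) ^ (K E₀ B₀) := one_le_pow₀ one_le_two
    nlinarith
  obtain ⟨k, hk1, hk2⟩ := exists_nat_pow_near hG2c one_lt_two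
  -- `k > K`
  have hkK : K E₀ B₀ < k := by
    have h1 : (2 : ℝ) ^ (K E₀ B₀ + 1) < G / (2 * cc) := by
      rw [lt_div_iff₀ (by positivity), pow_succ]; linarith
    have h2 : (2 : ℝ) ^ (K E₀ B₀ + 1) < (2 : ℝ) ^ (k + 1) := h1.trans hk2
    have := (pow_lt_pow_iff_right₀ (one_lt_two : (1 : ℝ) < 2)).1 h2
    omega
  -- `V_{G/2} ≤ V k` (level `2^k cc ≤ G/2`)
  have hlev : (2 : ℝ) ^ k * cc ≤ G / 2 := by
    rw [le_div_iff₀ (by positivity)] at hk1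
    linarith
  have hmono : (∫⁻ τ in Ioo 0 T, volume {x | G / 2 < ‖u τ x‖}).toReal ≤ V k := by
    refine ENNReal.toReal_mono (hVfin _ (by positivity)) (lintegral_mono fun τ => ?_)
    exact measure_mono fun y hy => lt_of_le_of_lt hlev hy
  -- `G < 2^{k+2} cc`
  have hGlt : G < (2 : ℝ) ^ (k + 2) * cc := by
    rw [div_lt_iff₀ (by positivity)] at hk2
    calc G < (2 : ℝ) ^ (k + 1) * (2 * cc) := hk2
      _ = (2 : ℝ) ^ (k + 2) * cc := by ring
  -- the exponent and the powers of two
  set e : ℝ := γ * ((k : ℝ) * ((k : ℝ) - 1) / 2) with he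
  have hhalf : (1 / 2 : ℝ) ^ k = (2 : ℝ) ^ (-(k : ℝ)) := by
    rw [Real.rpow_neg zero_le_two, Real.rpow_natCast, one_div, inv_pow]
  have hpow2 : ((2 : ℝ) ^ (k + 2) * cc) ^ 5 = (2 : ℝ) ^ (10 : ℝ) * (2 : ℝ) ^ (5 * (k : ℝ)) * cc ^ 5 := by
    have h1 : ((2 : ℝ) ^ (k + 2)) ^ 5 = (2 : ℝ) ^ (10 : ℝ) * (2 : ℝ) ^ (5 * (k : ℝ)) := by
      rw [← Real.rpow_add two_pos, ← pow_mul, ← Real.rpow_natCast]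
      congr 1; push_cast; ring
    rw [mul_pow, h1]
  have hnk : (2 : ℝ) ^ (-(k : ℝ)) * (2 : ℝ) ^ (5 * (k : ℝ)) = (2 : ℝ) ^ (4 * (k : ℝ)) := by
    rw [← Real.rpow_add two_pos]; ring_nf
  have hneg : (2 : ℝ) ^ (-e) * (2 : ℝ) ^ e = 1 := by
    rw [← Real.rpow_add two_pos, neg_add_cancel, Real.rpow_zero]
  have hE : 0 < (2 : ℝ) ^ e := Real.rpow_pos_of_pos two_pos e
  -- `κ ν⁴ ≤ V k · G⁵ ≤ (T E₀/cc²) 2^{-k} 2^{-e} G⁵`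
  have hQ' : κ * ν ^ 4 ≤ V k * G ^ 5 := by
    have := hquant.trans hmono
    rwa [div_le_iff₀ (by positivity)] at this
  have hVk_le : V k ≤ T * E₀ / cc ^ 2 * (2 : ℝ) ^ (-(k : ℝ)) * (2 : ℝ) ^ (-e) := by
    have h1 := hind k
    rw [hhalf] at h1
    refine h1.trans ?_
    gcongr
  -- the case `E₀ = 0` is immediate (`V k = 0` would force `κ ν⁴ ≤ 0`)
  rcases eq_or_lt_of_le hE₀0 with hE0 | hEpos
  · have : V k ≤ 0 := by rw [← hE0] at hVk_le; simpa using hVk_le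
    have hVk0 : 0 ≤ V k := ENNReal.toReal_nonneg
    have : V k * G ^ 5 = 0 := by rw [le_antisymm this hVk0, zero_mul]
    have : κ * ν ^ 4 ≤ 0 := by rw [this] at hQ'; exact hQ'
    have : 0 < κ * ν ^ 4 := by positivity
    linarith
  have hG5 : G ^ 5 < (2 : ℝ) ^ (10 : ℝ) * (2 : ℝ) ^ (5 * (k : ℝ)) * cc ^ 5 := by
    calc G ^ 5 < ((2 : ℝ) ^ (k + 2) * cc) ^ 5 := pow_lt_pow_left₀ hGlt hGpos.le (by norm_num)
      _ = _ := hpow2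
  have hfacpos : 0 < T * E₀ / cc ^ 2 * (2 : ℝ) ^ (-(k : ℝ)) * (2 : ℝ) ^ (-e) := by positivity
  have hstrict : κ * ν ^ 4 < T * E₀ / cc ^ 2 * (2 : ℝ) ^ (-(k : ℝ)) * (2 : ℝ) ^ (-e) *
      ((2 : ℝ) ^ (10 : ℝ) * (2 : ℝ) ^ (5 * (k : ℝ)) * cc ^ 5) := by
    calc κ * ν ^ 4 ≤ V k * G ^ 5 := hQ'
      _ ≤ T * E₀ / cc ^ 2 * (2 : ℝ) ^ (-(k : ℝ)) * (2 : ℝ) ^ (-e) * G ^ 5 :=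
          mul_le_mul_of_nonneg_right hVk_le (by positivity)
      _ < _ := mul_lt_mul_of_pos_left hG5 hfacpos
  have hrhs : T * E₀ / cc ^ 2 * (2 : ℝ) ^ (-(k : ℝ)) * (2 : ℝ) ^ (-e) *
      ((2 : ℝ) ^ (10 : ℝ) * (2 : ℝ) ^ (5 * (k : ℝ)) * cc ^ 5) =
      T * E₀ * cc ^ 3 * (2 : ℝ) ^ (10 : ℝ) * (2 : ℝ) ^ (4 * (k : ℝ)) * (2 : ℝ) ^ (-e) := by
    rw [← hnk]
    field_simp
  rw [hrhs] at hstrict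
  -- multiply by `2^e`: `κ ν⁴ 2^e < T E₀ cc³ 2^{10} 2^{4k}`
  have hstrict' : κ * ν ^ 4 * (2 : ℝ) ^ e < T * E₀ * cc ^ 3 * (2 : ℝ) ^ (10 : ℝ) * (2 : ℝ) ^ (4 * (k : ℝ)) := by
    have := mul_lt_mul_of_pos_right hstrict hE
    calc κ * ν ^ 4 * (2 : ℝ) ^ e < T * E₀ * cc ^ 3 * (2 : ℝ) ^ (10 : ℝ) * (2 : ℝ) ^ (4 * (k : ℝ)) *
          (2 : ℝ) ^ (-e) * (2 : ℝ) ^ e := this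
      _ = T * E₀ * cc ^ 3 * (2 : ℝ) ^ (10 : ℝ) * (2 : ℝ) ^ (4 * (k : ℝ)) * ((2 : ℝ) ^ (-e) * (2 : ℝ) ^ e) := by
          ring
      _ = _ := by rw [hneg, mul_one]
  -- the choice of `K`: `Ξ 2^{4k} ≤ 2^e`, i.e. `T E₀ cc³ 2^{10} 2^{4k} ≤ κ ν⁴ 2^e`
  have hdom := hKspec E₀ B₀ k hkK
  have hdom' : T * E₀ * cc ^ 3 * (2 : ℝ) ^ (10 : ℝ) * (2 : ℝ) ^ (4 * (k : ℝ)) ≤ κ * ν ^ 4 * (2 : ℝ) ^ e := by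
    have h1 : Ξ E₀ B₀ = T * E₀ * cc ^ 3 * (2 : ℝ) ^ (10 : ℝ) / (κ * ν ^ 4) := by
      show T * max E₀ 0 * (c₁ E₀ B₀) ^ 3 * (2 : ℝ) ^ (10 : ℝ) / (κ * ν ^ 4) = _
      rw [hmaxE]
    rw [h1, div_mul_eq_mul_div, div_le_iff₀ (by positivity)] at hdom
    linarith
  linarith


/-- **AREA LAW ∧ BOUNDED PAIRING BOOKKEEPING ⇒ THE CRUX** (the composition of line
`iso-speed-area-closure`, with the closure proved above): on each fibre `(ν, T)` the area law gives
`(m₁, Λ₁)`; `levelSetModeration_areaLawClosure` gives the class-uniform bound `G(E₀,B₀)`; the bookkeeping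
gives the modulus `F`; the crux holds with exponent `0 < 10/3` (`M⁰ = 1`). [folklore] -/
theorem levelSetModeration_highSpeedPressureWork_of_areaLaw_of_bookkeeping : (∀ (ν T : ℝ), 0 < ν → 0 < T → ∃ m₁ : ℝ, m₁ < 5 / 3 ∧ ∃ Λ₁ : ℝ → ℝ → ℝ, ∀ (u : ℝ → EuclideanSpace ℝ (Fin 3) → EuclideanSpace ℝ (Fin 3)) (p : ℝ → EuclideanSpace ℝ (Fin 3) → ℝ), Literature.Analysis.FluidPDE.IsClassicalNSSolutionOn (Set.Ico 0 T) ν 0 u p → Literature.Analysis.FluidPDE.IsLerayHopfOn T ν 0 (u 0) u → Literature.Analysis.FluidPDE.HasRapidSpatialDecay (u 0) → ∀ (E₀ B₀ : ℝ), (∫ x, ‖u 0 x‖ ^ 2) ≤ E₀ → (∀ x, ‖u 0 x‖ ≤ B₀) → ∀ (M c : ℝ), 2 * B₀ ≤ M → M / 2 ≤ c → c ≤ M → 0 < c → ν * (∫⁻ τ in Set.Ioo 0 T, ∫⁻ x, Set.indicator {x | c < ‖u τ x‖} (fun x => ENNReal.ofReal ‖fderiv ℝ (fun y => ‖u τ y‖)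 x‖) x).toReal ≤ Λ₁ E₀ B₀ * M ^ m₁ * (∫⁻ τ in Set.Ioo 0 T, volume {x | c < ‖u τ x‖}).toReal) → (∀ (ν T : ℝ), 0 < ν → 0 < T → ∀ G : ℝ → ℝ → ℝ, (∀ (u : ℝ → EuclideanSpace ℝ (Fin 3) → EuclideanSpace ℝ (Fin 3)) (p : ℝ → EuclideanSpace ℝ (Fin 3) → ℝ), Literature.Analysis.FluidPDE.IsClassicalNSSolutionOn (Set.Ico 0 T) ν 0 u p → Literature.Analysis.FluidPDE.IsLerayHopfOn T ν 0 (u 0) u → Literature.Analysis.FluidPDE.HasRapidSpatialDecay (u 0) → ∀ (E₀ B₀ : ℝ), (∫ x, ‖u 0 x‖ ^ 2) ≤ E₀ → (∀ x, ‖u 0 x‖ ≤ B₀) → ∀ t ∈ Set.Ico 0 T, ∀ x, ‖u t x‖ ≤ G E₀ B₀) → ∃ F : ℝ → ℝ → ℝ, ∀ (u : ℝ → EuclideanSpace ℝ (Fin 3) → EuclideanSpace ℝ (Fin 3)) (p : ℝ → EuclideanSpace ℝ (Fin 3) → ℝ), Literature.Analysis.FluidPDE.IsClassicalNSSolutionOn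 (Set.Ico 0 T) ν 0 u p → Literature.Analysis.FluidPDE.IsLerayHopfOn T ν 0 (u 0) u → Literature.Analysis.FluidPDE.HasRapidSpatialDecay (u 0) → ∀ (E₀ B₀ : ℝ), (∫ x, ‖u 0 x‖ ^ 2) ≤ E₀ → (∀ x, ‖u 0 x‖ ≤ B₀) → ∀ (M c t : ℝ), 2 * B₀ ≤ M → M / 2 ≤ c → c ≤ M → 0 < c → t ∈ Set.Ico 0 T → -(∫ τ in Set.Ioo 0 t, ∫ x, max (1 - c / ‖u τ x‖) 0 * (fderiv ℝ (Literature.Analysis.FluidPDE.normalisedPressure (u τ)) x (u τ x))) ≤ Real.sqrt (F E₀ B₀ * (∫⁻ τ in Set.Ioo 0 T, volume {x | c < ‖u τ x‖}).toReal) * Real.sqrt ((∫⁻ τ in Set.Ioo 0 T, ∫⁻ x, Set.indicator {x | c < ‖u τ x‖} (fun x => ENNReal.ofReal (‖fderiv ℝ (fun y => ‖u τ y‖) x‖ ^ 2)) x).toReal)) → Summit.NavierStokesRegularity.NavierStokesRegularity.Theses.LevelSetModeration.HighSpeedPressureWork := by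
  intro hA hB ν T hν hT
  obtain ⟨m₁, hm₁, Λ₁, hlaw⟩ := hA ν T hν hT
  obtain ⟨G, hG⟩ := levelSetModeration_areaLawClosure ν T hν hT m₁ Λ₁ hm₁ hlaw
  obtain ⟨F, hF⟩ := hB ν T hν hT G hG
  refine ⟨0, by norm_num, F, ?_⟩
  intro u p hcl hLH hdec E₀ B₀ hE₀ hB₀ M c t hM hMc hcM hc ht
  have h := hF u p hcl hLH hdec E₀ B₀ hE₀ hB₀ M c t hM hMc hcM hc ht
  rwa [Real.rpow_zero, mul_one]

/-- **THE CRUX IS EQUIVALENT TO (AREA LAW ∧ BOUNDED PAIRING BOOKKEEPING)**: `⇒` by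
`levelSetModeration_isoSpeedAreaLaw_of_highSpeedPressureWork` (Cauchy–Schwarz) and
`levelSetModeration_boundedPairingBookkeeping_of_highSpeedPressureWork` (exponent collapse); `⇐` by
`levelSetModeration_highSpeedPressureWork_of_areaLaw_of_bookkeeping`. Together with
`levelSetModeration_highSpeedPressureWork_iff_linearLaw_and_bookkeeping` (crux ⟺ L1 ∧ L3) this pins the
open content of the crux to the WEAKEST law of the route: the iso-speed area law with `m₁ < 5/3`.
[folklore] -/
theorem levelSetModeration_highSpeedPressureWork_iff_areaLaw_and_bookkeeping : Summit.NavierStokesRegularity.NavierStokesRegularity.Theses.LevelSetModeration.HighSpeedPressureWork ↔ ((∀ (ν T : ℝ), 0 < ν → 0 < T → ∃ m₁ : ℝ, m₁ < 5 / 3 ∧ ∃ Λ₁ : ℝ → ℝ → ℝ, ∀ (u : ℝ → EuclideanSpace ℝ (Fin 3) → EuclideanSpace ℝ (Fin 3)) (p : ℝ → EuclideanSpace ℝ (Fin 3) → ℝ), Literature.Analysis.FluidPDE.IsClassicalNSSolutionOn (Set.Ico 0 T) ν 0 u p → Literature.Analysis.FluidPDE.IsLerayHopfOn T ν 0 (u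 0) u → Literature.Analysis.FluidPDE.HasRapidSpatialDecay (u 0) → ∀ (E₀ B₀ : ℝ), (∫ x, ‖u 0 x‖ ^ 2) ≤ E₀ → (∀ x, ‖u 0 x‖ ≤ B₀) → ∀ (M c : ℝ), 2 * B₀ ≤ M → M / 2 ≤ c → c ≤ M → 0 < c → ν * (∫⁻ τ in Set.Ioo 0 T, ∫⁻ x, Set.indicator {x | c < ‖u τ x‖} (fun x => ENNReal.ofReal ‖fderiv ℝ (fun y => ‖u τ y‖) x‖) x).toReal ≤ Λ₁ E₀ B₀ * M ^ m₁ * (∫⁻ τ in Set.Ioo 0 T, volume {x | c < ‖u τ x‖}).toReal) ∧ (∀ (ν T : ℝ), 0 < ν → 0 < T → ∀ G : ℝ → ℝ → ℝ, (∀ (u : ℝ → EuclideanSpace ℝ (Fin 3) → EuclideanSpace ℝ (Fin 3)) (p : ℝ → EuclideanSpace ℝ (Fin 3) → ℝ), Literature.Analysis.FluidPDE.IsClassicalNSSolutionOn (Set.Ico 0 T) ν 0 u p → Literature.Analysis.FluidPDE.IsLerayHopfOn T ν 0 (u 0) u → Literature.Analysis.FluidPDE.HasRapidSpatialDecay (u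 0) → ∀ (E₀ B₀ : ℝ), (∫ x, ‖u 0 x‖ ^ 2) ≤ E₀ → (∀ x, ‖u 0 x‖ ≤ B₀) → ∀ t ∈ Set.Ico 0 T, ∀ x, ‖u t x‖ ≤ G E₀ B₀) → ∃ F : ℝ → ℝ → ℝ, ∀ (u : ℝ → EuclideanSpace ℝ (Fin 3) → EuclideanSpace ℝ (Fin 3)) (p : ℝ → EuclideanSpace ℝ (Fin 3) → ℝ), Literature.Analysis.FluidPDE.IsClassicalNSSolutionOn (Set.Ico 0 T) ν 0 u p → Literature.Analysis.FluidPDE.IsLerayHopfOn T ν 0 (u 0) u → Literature.Analysis.FluidPDE.HasRapidSpatialDecay (u 0) → ∀ (E₀ B₀ : ℝ), (∫ x, ‖u 0 x‖ ^ 2) ≤ E₀ → (∀ x, ‖u 0 x‖ ≤ B₀) → ∀ (M c t : ℝ), 2 * B₀ ≤ M → M / 2 ≤ c → c ≤ M → 0 < c → t ∈ Set.Ico 0 T → -(∫ τ in Set.Ioo 0 t, ∫ x, max (1 - c / ‖u τ x‖) 0 * (fderiv ℝ (Literature.Analysis.FluidPDE.normalisedPressure (u τ)) x (u τ x))) ≤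 Real.sqrt (F E₀ B₀ * (∫⁻ τ in Set.Ioo 0 T, volume {x | c < ‖u τ x‖}).toReal) * Real.sqrt ((∫⁻ τ in Set.Ioo 0 T, ∫⁻ x, Set.indicator {x | c < ‖u τ x‖} (fun x => ENNReal.ofReal (‖fderiv ℝ (fun y => ‖u τ y‖) x‖ ^ 2)) x).toReal))) :=
  ⟨fun h => ⟨levelSetModeration_isoSpeedAreaLaw_of_highSpeedPressureWork h,
    levelSetModeration_boundedPairingBookkeeping_of_highSpeedPressureWork h⟩,
   fun h => levelSetModeration_highSpeedPressureWork_of_areaLaw_of_bookkeeping h.1 h.2⟩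

end Summit.NavierStokesRegularity.NavierStokesRegularity.Theorems

end
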